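import Mathlib

/-!
# Sketch (ideator 2, crux stmt-FinalStateConjecture-17839 `FinalStateFromKerrOrBomb`)
## Part I — the spiral-crossing lemma (finite-dimensional, Mathlib only)

A path into the origin of the plane with a bounded continuous argument (e.g. a `C¹` arc with
non-zero tangent, the projection of an IMMERSED, transversally exciting witness curve onto the
top unstable plane of an oscillatory bomb) meets every logarithmic spiral (the trace, in that
plane, of a codimension-one bad stratum pulled back along the explosion spiral) at parameters
accumulating at `0`.  Written in log-polar form `γ(c) = e^{ρ(c)} e^{iθ(c)}`.
-/

open Filter Topology Set

set_option linter.dupNamespace false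

namespace Summit.FinalStateConjecture.FinalStateConjecture.Cruxes.FinalStateFromKerrOrBomb.Ideator2

/-- The logarithmic spiral of scale `r₀` and pitch `κ`: the points `r₀ e^{κφ} e^{iφ}`, `φ ∈ ℝ`
(the planar orbit of the linear saddle-focus flow `ż = (ν + iϖ) z`, `κ = ν/ϖ`). -/
def logSpiral (r₀ κ : ℝ) : Set ℂ :=
  range fun φ : ℝ ↦ ((r₀ * Real.exp (κ * φ) : ℝ) : ℂ) * Complex.exp ((φ : ℂ) * Complex.I)

/-- **Crossing-function lemma.** A real function continuous on `(0, 1]` and divergent at `0⁺`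
takes the values `2πk`, `k ∈ ℤ`, at parameters accumulating at `0`. (IVT.) -/
theorem frequently_eq_two_pi_mul_int {g : ℝ → ℝ} (hg : ContinuousOn g (Ioc 0 1))
    (hdiv : Tendsto g (𝓝[>] 0) atTop ∨ Tendsto g (𝓝[>] 0) atBot) :
    ∃ᶠ c in 𝓝[>] (0 : ℝ), ∃ k : ℤ, g c = 2 * Real.pi * k := by
  rw [frequently_nhdsWithin_iff, frequently_nhds_iff]
  intro U h0U hU
  -- a small parameter ε ∈ (0,1] with (0, ε] ⊆ U
  obtain ⟨ε, hε, hεU⟩ : ∃ ε : ℝ, 0 < ε ∧ ε ≤ 1 ∧ Ioc 0 ε ⊆ U := by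
    obtain ⟨δ, hδ, hball⟩ := Metric.isOpen_iff.1 hU 0 h0U
    refine ⟨min (δ / 2) 1, by positivity, min_le_right _ _, fun c hc ↦ hball ?_⟩
    rw [Metric.mem_ball, Real.dist_eq, sub_zero, abs_of_pos hc.1]
    exact lt_of_le_of_lt (hc.2.trans (min_le_left _ _)) (by linarith)
  obtain ⟨hε1, hsub⟩ := hεU
  have hπ : 0 < 2 * Real.pi := by positivity
  -- pick an integer level beyond g ε in the direction of divergence, and a point δ < ε beyond it
  rcases hdiv with hdiv | hdiv
  · -- g → +∞
    obtain ⟨k, hk⟩ : ∃ k : ℤ, g ε < 2 * Real.pi * k := by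
      obtain ⟨k, hk⟩ := exists_int_gt (g ε / (2 * Real.pi))
      exact ⟨k, by rwa [div_lt_iff₀ hπ, mul_comm] at hk⟩
    have hev : ∀ᶠ c in 𝓝[>] (0 : ℝ), 2 * Real.pi * k < g c := hdiv.eventually_gt_atTop _
    have hev' : ∀ᶠ c in 𝓝[>] (0 : ℝ), c < ε := by
      exact (eventually_nhdsWithin_of_eventually_nhds (eventually_lt_nhds hε))
    obtain ⟨δ, ⟨hδk, hδε⟩, hδ0⟩ := ((hev.and hev').and self_mem_nhdsWithin).exists
    -- IVT on [δ, ε]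
    have hcont : ContinuousOn g (Icc δ ε) :=
      hg.mono fun c hc ↦ ⟨lt_of_lt_of_le hδ0 hc.1, hc.2.trans hε1⟩
    have hmem : (2 * Real.pi * k : ℝ) ∈ Icc (g ε) (g δ) := ⟨hk.le, hδk.le⟩
    obtain ⟨c, hc, hgc⟩ :=
      intermediate_value_Icc' hδε.le hcont hmem
    exact ⟨c, hsub ⟨lt_of_lt_of_le hδ0 hc.1, hc.2⟩, ⟨k, hgc⟩, lt_of_lt_of_le hδ0 hc.1⟩
  · -- g → -∞
    obtain ⟨k, hk⟩ : ∃ k : ℤ, 2 * Real.pi * k < g ε := by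
      obtain ⟨k, hk⟩ := exists_int_lt (g ε / (2 * Real.pi))
      exact ⟨k, by rwa [lt_div_iff₀ hπ, mul_comm] at hk⟩
    have hev : ∀ᶠ c in 𝓝[>] (0 : ℝ), g c < 2 * Real.pi * k := hdiv.eventually_lt_atBot _
    have hev' : ∀ᶠ c in 𝓝[>] (0 : ℝ), c < ε := by
      exact (eventually_nhdsWithin_of_eventually_nhds (eventually_lt_nhds hε))
    obtain ⟨δ, ⟨hδk, hδε⟩, hδ0⟩ := ((hev.and hev').and self_mem_nhdsWithin).exists
    have hcont : ContinuousOn g (Icc δ ε) :=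
      hg.mono fun c hc ↦ ⟨lt_of_lt_of_le hδ0 hc.1, hc.2.trans hε1⟩
    have hmem : (2 * Real.pi * k : ℝ) ∈ Icc (g δ) (g ε) := ⟨hδk.le, hk.le⟩
    obtain ⟨c, hc, hgc⟩ :=
      intermediate_value_Icc hδε.le hcont hmem
    exact ⟨c, hsub ⟨lt_of_lt_of_le hδ0 hc.1, hc.2⟩, ⟨k, hgc⟩, lt_of_lt_of_le hδ0 hc.1⟩

/-- Points of the log-polar path lie on the spiral whenever the crossing function
`g = (ρ − log r₀)/κ − θ` takes a value in `2πℤ`. -/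
theorem mem_logSpiral_of_eq {r₀ κ : ℝ} (hr₀ : 0 < r₀) (hκ : κ ≠ 0) {ρ θ : ℝ} {k : ℤ}
    (h : (ρ - Real.log r₀) / κ - θ = 2 * Real.pi * k) :
    ((Real.exp ρ : ℝ) : ℂ) * Complex.exp ((θ : ℂ) * Complex.I) ∈ logSpiral r₀ κ := by
  refine ⟨θ + 2 * Real.pi * k, ?_⟩
  have hκφ : κ * (θ + 2 * Real.pi * k) = ρ - Real.log r₀ := by
    rw [← h]; field_simp; ring
  have hmod : r₀ * Real.exp (κ * (θ + 2 * Real.pi * k)) = Real.exp ρ := by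
    rw [hκφ, Real.exp_sub, Real.exp_log hr₀]; field_simp
  have harg : Complex.exp (((θ + 2 * Real.pi * k : ℝ) : ℂ) * Complex.I) =
      Complex.exp ((θ : ℂ) * Complex.I) := by
    push_cast
    rw [add_mul, Complex.exp_add]
    have : Complex.exp (2 * (Real.pi : ℂ) * (k : ℂ) * Complex.I) = 1 := by
      have := Complex.exp_int_mul_two_pi_mul_I k
      rw [← this]; ring_nf
    rw [this, mul_one]
  simp only [hmod, harg]

/-- **Spiral-crossing lemma.** If `ρ → −∞` at `0⁺` (the path runs into the origin) while the
argument `θ` stays bounded and both are continuous on `(0,1]`, the path `e^{ρ} e^{iθ}` meets the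
spiral `logSpiral r₀ κ` (`r₀ > 0`, `κ ≠ 0`) at parameters accumulating at `0`. -/
theorem spiral_crossing {r₀ κ : ℝ} (hr₀ : 0 < r₀) (hκ : κ ≠ 0) {ρ θ : ℝ → ℝ}
    (hρ : ContinuousOn ρ (Ioc 0 1)) (hθ : ContinuousOn θ (Ioc 0 1))
    (hρ0 : Tendsto ρ (𝓝[>] 0) atBot)
    (hθb : ∃ B : ℝ, ∀ c ∈ Ioc (0 : ℝ) 1, |θ c| ≤ B) :
    ∃ᶠ c in 𝓝[>] (0 : ℝ),
      ((Real.exp (ρ c) : ℝ) : ℂ) * Complex.exp ((θ c : ℂ) * Complex.I) ∈ logSpiral r₀ κ := by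
  set g : ℝ → ℝ := fun c ↦ (ρ c - Real.log r₀) / κ - θ c with hg
  have hgc : ContinuousOn g (Ioc 0 1) :=
    ((hρ.sub continuousOn_const).div_const κ).sub hθ
  obtain ⟨B, hB⟩ := hθb
  -- θ is eventually bounded along 𝓝[>] 0
  have hθev : ∀ᶠ c in 𝓝[>] (0 : ℝ), |θ c| ≤ B := by
    have : Ioc (0 : ℝ) 1 ∈ 𝓝[>] (0 : ℝ) := Ioc_mem_nhdsGT one_pos
    exact mem_of_superset this fun c hc ↦ hB c hc
  have hdiv : Tendsto g (𝓝[>] 0) atTop ∨ Tendsto g (𝓝[>] 0) atBot := by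
    -- (ρ - log r₀)/κ diverges (sign of κ), θ is bounded
    have h1 : Tendsto (fun c ↦ ρ c - Real.log r₀) (𝓝[>] 0) atBot :=
      hρ0.atBot_add tendsto_const_nhds
    rcases lt_or_gt_of_ne hκ with hneg | hpos
    · left
      have h2 : Tendsto (fun c ↦ (ρ c - Real.log r₀) / κ) (𝓝[>] 0) atTop :=
        (h1.atBot_mul_const_of_neg (inv_lt_zero.2 hneg)).congr fun _ ↦ by
          simp [div_eq_mul_inv]
      have h3 := tendsto_atTop_add_right_of_le' (l := 𝓝[>] (0 : ℝ)) (-B) h2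
        (hθev.mono fun c hc ↦ (neg_le_neg ((le_abs_self _).trans hc)))
      exact h3.congr fun c ↦ by simp [hg, sub_eq_add_neg]
    · right
      have h2 : Tendsto (fun c ↦ (ρ c - Real.log r₀) / κ) (𝓝[>] 0) atBot :=
        h1.atBot_div_const hpos
      have h3 := tendsto_atBot_add_right_of_ge' (l := 𝓝[>] (0 : ℝ)) B h2
        (hθev.mono fun c hc ↦ ((neg_le_abs _).trans hc))
      exact h3.congr fun c ↦ by simp [hg, sub_eq_add_neg]
  refine (frequently_eq_two_pi_mul_int hgc hdiv).mono fun c ⟨k, hk⟩ ↦ ?_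
  exact mem_logSpiral_of_eq hr₀ hκ hk

end Summit.FinalStateConjecture.FinalStateConjecture.Cruxes.FinalStateFromKerrOrBomb.Ideator2
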